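import Literature.AnabelianGeometry.EtaleTheta.SettingModelChiMuTwoInversionCusp
import Literature.AnabelianGeometry.EtaleTheta.Discharge.Sec2OuterPairOfCLevelData
import Literature.AnabelianGeometry.EtaleTheta.Discharge.Sec2OuterEtaChiModel
import HarnessLib

/-!
# [EtTh] Cor. 2.8 (iii), OUTER case, at the χ-twisted inversion model: the automorphism pairs of
# `Π^tp_C = Π^tp_X ⋊_ι ℤ/2` FIRE with their P-C5 identity (proof-only)

S. Mochizuki, *The étale theta function and its Frobenioid-theoretic manifestations*, Publ. RIMS **45** (2009) [EtTh],
Def. 1.7 p. 27, §2 p. 36 («`ι` … “multiplication by `−1`”»), Rmk. 1.9.1 p. 29, Cor. 2.8 (iii) p. 42 («if `γ` arises from an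
inner automorphism of `Π^tp_{Ċ̲}` …») [cite: MochizukiEtTh2009, Cor 2.8(iii) p.42].  abc-iut cell, layer L2, seat
abc-iut-w6-d083 (gen 3; part (2) «OUTER PAIRS FIRE at inversionModelχ» of the self-named sequel of R247, split with
abc-iut-w5-d140 g4 11:57:52Z: part (1) = its `SettingModelChiMuTwoInversionCusp`, p443309 — `augCInvχ`, `cLevelDataInvχ`,
`conjX_epsPMInvχ`, consumed BY NAME).  PROOF-ONLY (0 def, 0 instance) over abc-iut-L2-d3's PARAMETER record
`MuTwoSetting.CLevelData` (`conjX`, `inclX_conjX`, `map_deltaTemp_conjX`), abc-iut-w6-d051's outer-pair support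
(`Discharge/Sec2OuterPairOfCLevelData`: `outer_pair_equations`), abc-iut-L6-d5's `Thm16Sub.topCompanion`, abc-iut-w5-d111's
`isQuotientMap_toTheta_modelχ`, abc-iut-L2-d1's `thm16i_twistedInversion_modelχ`, and this seat's P-C5 file
(`Discharge/Sec2OuterEtaChiModel`, p443069: `exists_autMap_symm_etaDdχ_eq_conj`, `eq_conj_invActionχ_of_inclInvχ`):
* §1 for EVERY `e : (inversionModelχ p).CLevelData`: `conjX_apply_inversionModelχ` (`e.conjX x = conj_{x₁} ∘ φ_{x₂}` on the
  nose), `conjX_epsPM_inversionModelχ` (`e.conjX ε_± =` the twisted inversion, for every `e`), `invActionχ_mem_GtpYdd`,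
  `conjX_mem_GtpYdd_inversionModelχ` (`e.conjX x` preserves `Π^tp_Ÿ` — the capstones' binder `hY`);
* §2 **`outer_pair_pC5_inversionModelχ`** — THE JUNCTION: for every `e` and every `x ∈ Π^tp_C`, the outer pair
  `(α, β) := (e.conjX x, topCompanion …)` satisfies the pair equations `inclX ∘ α = conj_x ∘ inclX`, `β ∘ θ = θ ∘ α`, the
  stability binders `hΔ'`, `hY`, AND P-C5 `autMap α⁻¹ β⁻¹ η̈^Θ = ContH1.conj σ₀ η̈^Θ` with `σ₀ = (φ_{x₂} x₁)⁻¹`;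
  `outer_pair_pC5_epsPM_inversionModelχ` (`x = ε_±`: the inversion pair fixes `η̈^Θ`); and the instances at abc-iut-w5-d140's
  record, `outer_pair_pC5_cLevelDataInvχ` — so at the χ-model the binders {pair equations, `hΔ'`, `hY`, `hη`} of the
  reduced OUTER capstones (`ofEmbedding_cor28_iii_outer_reduced`, p437630) are ALL THEOREMS; the one input left there is
  abc-iut-L2-d3's `OrbitEmbedding` at the model (`hXuι`, `σ₀ ∈ ε.dotXuu`).
HONEST LIMITS: semi-synthetic model (consistency / non-vacuity evidence for the typed interface only; `Π^tp_C` is the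
semidirect product by the model's inversion, not the tempered fundamental group of an orbicurve); nothing of [EtTh] is
asserted; no side is taken on [IUTchIII] Cor. 3.12; typed ≠ proved; instantiated ≠ endorsed.
-/

noncomputable section

namespace Literature.AnabelianGeometry.EtaleTheta.SettingModel

open Literature.AnabelianGeometry.SemiGraphs Literature.IUT.HodgeArakelov _root_.Topology _root_.Function
open ThetaSetting.EtaleThetaData.DoubleUnderline.OrbitEmbedding (symm_toTheta_eq)

variable {p : ℕ} [Fact p.Prime]

/-! ## §1. `e.conjX` at the inversion model, for EVERY C-level datum `e` -/

variable (e : (MuTwoSetting.inversionModelχ p).CLevelData)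

/-- **`e.conjX x = conj_{x₁} ∘ φ_{x₂}` on the nose** (`x = (x₁, x₂) ∈ Π^tp_X ⋊_ι ℤ/2`; `conjX` depends on `e` only through
continuity). [cite: MochizukiEtTh2009, §2 p.36] -/
theorem conjX_apply_inversionModelχ (x : PiCInvχ p) (g : PiTpχ p) :
    e.conjX x g = x.left * invActionχ p x.right g * x.left⁻¹ :=
  eq_conj_invActionχ_of_inclInvχ p x (e.conjX x) (fun g => e.inclX_conjX x g) g

/-- **`e.conjX ε_±` is the twisted inversion.** [cite: MochizukiEtTh2009, §2 p.36] -/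
theorem conjX_epsPM_inversionModelχ :
    e.conjX (MuTwoSetting.inversionModelχ p).epsPM = twistedInversionTop (chi p) (isInducing_leftRightχ p) := by
  refine ContinuousMulEquiv.ext fun x => (MuTwoSetting.inversionModelχ p).injective_inclX ?_
  rw [e.inclX_conjX]
  exact MuTwoSetting.inversionModelχ_epsPM_conj p x

/-- `φ_z` preserves `Π^tp_Ÿ` (`z ∈ ℤ/2`; abc-iut-L2-d1's `thm16i_twistedInversion_modelχ`). [cite: MochizukiEtTh2009, Thm 1.6 (i) p.24] -/
theorem invActionχ_mem_GtpYdd (z : Multiplicative (ZMod 2)) {g : PiTpχ p} (hg : g ∈ (ThetaSetting.modelχ p).GtpYdd) :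
    invActionχ p z g ∈ (ThetaSetting.modelχ p).GtpYdd := by
  rcases invActionχ_eq p z with h | h <;> rw [h]
  · exact hg
  · have h16 := thm16i_twistedInversion_modelχ p
    change (ThetaSetting.modelχ p).GtpYdd.map _ = _ at h16
    rw [← h16]
    exact ⟨g, hg, rfl⟩

/-- **`e.conjX x` preserves `Π^tp_Ÿ`** for every `x ∈ Π^tp_C` (`Π^tp_Ÿ ⊴ Π^tp_X` by `Compat`, and `ι`-stable) — the binder `hY`
of the outer capstones. [cite: MochizukiEtTh2009, Thm 1.6 (i) p.24] -/
theorem conjX_mem_GtpYdd_inversionModelχ (x : PiCInvχ p) :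
    ∀ g, g ∈ (ThetaSetting.modelχ p).GtpYdd → e.conjX x g ∈ (ThetaSetting.modelχ p).GtpYdd := by
  haveI := (MuTwoSetting.inversionModelχ_compat p).GtpYdd_normal
  intro g hg
  rw [conjX_apply_inversionModelχ]
  exact Subgroup.Normal.conj_mem inferInstance _ (invActionχ_mem_GtpYdd x.right hg) _

/-! ## §2. The outer pairs of `Π^tp_C` FIRE at `inversionModelχ`, with their P-C5 identity -/

/-- **THE JUNCTION.** For every C-level datum `e` and every `x ∈ Π^tp_C = Π^tp_X ⋊_ι ℤ/2`, the outer pair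
`(α, β) := (e.conjX x, abc-iut-L6-d5's topological theta companion)` satisfies the pair equations `inclX ∘ α = conj_x ∘ inclX`,
`β ∘ θ = θ ∘ α`, the stability binders `hΔ'` (`β⁻¹(Δ_Θ) ⊆ Δ_Θ`), `hY` (`α(Π^tp_Ÿ) ⊆ Π^tp_Ÿ`), AND P-C5 for the model's theta
class: `autMap α⁻¹ β⁻¹ η̈^Θ = ContH1.conj σ₀ η̈^Θ` with `σ₀ = (φ_{x₂} x₁)⁻¹` — the binders of abc-iut-w6-d051's
`ofEmbedding_cor28_iii_outer_reduced` other than the `OrbitEmbedding` data are all DISCHARGED at the χ-model.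
[cite: MochizukiEtTh2009, Cor 2.8(iii) p.42] -/
theorem outer_pair_pC5_inversionModelχ (x : PiCInvχ p) :
    haveI := (MuTwoSetting.inversionModelχ_compat p).GtpYdd_normal
    ∃ (β : (ThetaSetting.modelχ p).GtpTheta ≃ₜ* (ThetaSetting.modelχ p).GtpTheta)
      (hβ : ∀ σ, β ((ThetaSetting.modelχ p).toTheta σ) = (ThetaSetting.modelχ p).toTheta (e.conjX x σ))
      (hΔ' : ∀ a, a ∈ (ThetaSetting.modelχ p).DeltaTheta → β.symm a ∈ (ThetaSetting.modelχ p).DeltaTheta)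
      (hY : ∀ g, g ∈ (ThetaSetting.modelχ p).GtpYdd → e.conjX x g ∈ (ThetaSetting.modelχ p).GtpYdd),
      (∀ σ : PiTpχ p, inclInvχ p (e.conjX x σ) = x * inclInvχ p σ * x⁻¹) ∧
      (∀ a, a ∈ (ThetaSetting.modelχ p).DeltaTheta → β a ∈ (ThetaSetting.modelχ p).DeltaTheta) ∧
      ContH1Aut.autMap (ThetaSetting.modelχ p).toTheta (ThetaSetting.modelχ p).DeltaTheta (e.conjX x).symm β.symm
          (symm_toTheta_eq hβ) hΔ' (H := (ThetaSetting.modelχ p).GtpYdd) (H' := (ThetaSetting.modelχ p).GtpYdd) hY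
          (etaDdχ p) =
        ContH1.conj (ThetaSetting.modelχ p).toTheta (ThetaSetting.modelχ p).DeltaTheta (invActionχ p x.right x.left)⁻¹
          (etaDdχ p) := by
  haveI := (MuTwoSetting.inversionModelχ_compat p).GtpYdd_normal
  obtain ⟨h₁, h₂, h₃⟩ := e.outer_pair_equations (isQuotientMap_toTheta_modelχ p) x
  have hΔ : ∀ a, a ∈ (ThetaSetting.modelχ p).DeltaTheta →
      Thm16Sub.topCompanion (ThetaSetting.modelχ p) (ThetaSetting.modelχ p) (e.conjX x) (e.map_deltaTemp_conjX x)
        (isQuotientMap_toTheta_modelχ p) (isQuotientMap_toTheta_modelχ p) a ∈ (ThetaSetting.modelχ p).DeltaTheta :=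
    fun a ha => h₃.le ⟨a, ha, rfl⟩
  have hΔ' : ∀ a, a ∈ (ThetaSetting.modelχ p).DeltaTheta →
      (Thm16Sub.topCompanion (ThetaSetting.modelχ p) (ThetaSetting.modelχ p) (e.conjX x) (e.map_deltaTemp_conjX x)
        (isQuotientMap_toTheta_modelχ p) (isQuotientMap_toTheta_modelχ p)).symm a ∈ (ThetaSetting.modelχ p).DeltaTheta := by
    intro a ha
    obtain ⟨b, hb, hba⟩ := h₃.ge ha
    have : (Thm16Sub.topCompanion (ThetaSetting.modelχ p) (ThetaSetting.modelχ p) (e.conjX x) (e.map_deltaTemp_conjX x)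
        (isQuotientMap_toTheta_modelχ p) (isQuotientMap_toTheta_modelχ p)).symm a = b := by
      rw [ContinuousMulEquiv.symm_apply_eq]; exact hba.symm
    rw [this]; exact hb
  refine ⟨_, h₂, hΔ', conjX_mem_GtpYdd_inversionModelχ e x, h₁, hΔ, ?_⟩
  obtain ⟨σ₀, rfl, h⟩ := exists_autMap_symm_etaDdχ_eq_conj p (MuTwoSetting.inversionModelχ_compat p) x (e.conjX x) _
    h₁ h₂ hΔ' (conjX_mem_GtpYdd_inversionModelχ e x)
  exact h

/-- At `x = ε_±` the pair is (the twisted inversion, its companion) and P-C5 reads `autMap ι⁻¹ β⁻¹ η̈^Θ = η̈^Θ`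
(`σ₀ = (ι 1)⁻¹ = 1`). [cite: MochizukiEtTh2009, Rmk 1.9.1 p.29] -/
theorem outer_pair_pC5_epsPM_inversionModelχ :
    haveI := (MuTwoSetting.inversionModelχ_compat p).GtpYdd_normal
    ∃ (β : (ThetaSetting.modelχ p).GtpTheta ≃ₜ* (ThetaSetting.modelχ p).GtpTheta)
      (hβ : ∀ σ, β ((ThetaSetting.modelχ p).toTheta σ) =
        (ThetaSetting.modelχ p).toTheta (e.conjX (MuTwoSetting.inversionModelχ p).epsPM σ))
      (hΔ' : ∀ a, a ∈ (ThetaSetting.modelχ p).DeltaTheta → β.symm a ∈ (ThetaSetting.modelχ p).DeltaTheta)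
      (hY : ∀ g, g ∈ (ThetaSetting.modelχ p).GtpYdd →
        e.conjX (MuTwoSetting.inversionModelχ p).epsPM g ∈ (ThetaSetting.modelχ p).GtpYdd),
      ContH1Aut.autMap (ThetaSetting.modelχ p).toTheta (ThetaSetting.modelχ p).DeltaTheta
          (e.conjX (MuTwoSetting.inversionModelχ p).epsPM).symm β.symm (symm_toTheta_eq hβ) hΔ'
          (H := (ThetaSetting.modelχ p).GtpYdd) (H' := (ThetaSetting.modelχ p).GtpYdd) hY (etaDdχ p) = etaDdχ p := by
  haveI := (MuTwoSetting.inversionModelχ_compat p).GtpYdd_normal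
  obtain ⟨β, hβ, hΔ', hY, -, -, h⟩ := outer_pair_pC5_inversionModelχ e (MuTwoSetting.inversionModelχ p).epsPM
  refine ⟨β, hβ, hΔ', hY, ?_⟩
  rw [h]
  change ContH1.conj _ _ (invActionχ p (Multiplicative.ofAdd (1 : ZMod 2)) 1)⁻¹ (etaDdχ p) = etaDdχ p
  rw [map_one, inv_one, ContH1.conj_one_apply]

/-- **The instance at abc-iut-w5-d140's record `cLevelDataInvχ p`** (so the statement is about a NAMED, inhabited C-level
datum): for every `x ∈ Π^tp_C` the outer pair through `cLevelDataInvχ` satisfies the pair equations, `hΔ'`, `hY` and P-C5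
with `σ₀ = (φ_{x₂} x₁)⁻¹`. [cite: MochizukiEtTh2009, Cor 2.8(iii) p.42] -/
theorem outer_pair_pC5_cLevelDataInvχ (p : ℕ) [Fact p.Prime] (x : PiCInvχ p) :
    haveI := (MuTwoSetting.inversionModelχ_compat p).GtpYdd_normal
    ∃ (β : (ThetaSetting.modelχ p).GtpTheta ≃ₜ* (ThetaSetting.modelχ p).GtpTheta)
      (hβ : ∀ σ, β ((ThetaSetting.modelχ p).toTheta σ) = (ThetaSetting.modelχ p).toTheta ((cLevelDataInvχ p).conjX x σ))
      (hΔ' : ∀ a, a ∈ (ThetaSetting.modelχ p).DeltaTheta → β.symm a ∈ (ThetaSetting.modelχ p).DeltaTheta)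
      (hY : ∀ g, g ∈ (ThetaSetting.modelχ p).GtpYdd → (cLevelDataInvχ p).conjX x g ∈ (ThetaSetting.modelχ p).GtpYdd),
      (∀ σ : PiTpχ p, inclInvχ p ((cLevelDataInvχ p).conjX x σ) = x * inclInvχ p σ * x⁻¹) ∧
      (∀ a, a ∈ (ThetaSetting.modelχ p).DeltaTheta → β a ∈ (ThetaSetting.modelχ p).DeltaTheta) ∧
      ContH1Aut.autMap (ThetaSetting.modelχ p).toTheta (ThetaSetting.modelχ p).DeltaTheta ((cLevelDataInvχ p).conjX x).symm
          β.symm (symm_toTheta_eq hβ) hΔ' (H := (ThetaSetting.modelχ p).GtpYdd) (H' := (ThetaSetting.modelχ p).GtpYdd) hY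
          (etaDdχ p) =
        ContH1.conj (ThetaSetting.modelχ p).toTheta (ThetaSetting.modelχ p).DeltaTheta (invActionχ p x.right x.left)⁻¹
          (etaDdχ p) :=
  outer_pair_pC5_inversionModelχ (cLevelDataInvχ p) x

/-- **NV HEADLINE.** At the χ-twisted inversion model there EXIST a C-level datum and, for every `x ∈ Π^tp_C`, an outer
automorphism pair through `inclX` with the pair equations, the stability binders and P-C5 for the model's theta class.
[cite: MochizukiEtTh2009, Cor 2.8(iii) p.42] -/
theorem exists_cLevelData_outer_pairs_pC5 (p : ℕ) [Fact p.Prime] :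
    haveI := (MuTwoSetting.inversionModelχ_compat p).GtpYdd_normal
    ∃ e : (MuTwoSetting.inversionModelχ p).CLevelData, ∀ x : PiCInvχ p,
      ∃ (α : (ThetaSetting.modelχ p).PiTemp ≃ₜ* (ThetaSetting.modelχ p).PiTemp)
        (β : (ThetaSetting.modelχ p).GtpTheta ≃ₜ* (ThetaSetting.modelχ p).GtpTheta)
        (hβ : ∀ σ, β ((ThetaSetting.modelχ p).toTheta σ) = (ThetaSetting.modelχ p).toTheta (α σ))
        (hΔ' : ∀ a, a ∈ (ThetaSetting.modelχ p).DeltaTheta → β.symm a ∈ (ThetaSetting.modelχ p).DeltaTheta)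
        (hY : ∀ g, g ∈ (ThetaSetting.modelχ p).GtpYdd → α g ∈ (ThetaSetting.modelχ p).GtpYdd),
        α = e.conjX x ∧ (∀ σ : PiTpχ p, inclInvχ p (α σ) = x * inclInvχ p σ * x⁻¹) ∧
        ∃ σ₀ : PiTpχ p,
          ContH1Aut.autMap (ThetaSetting.modelχ p).toTheta (ThetaSetting.modelχ p).DeltaTheta α.symm β.symm
              (symm_toTheta_eq hβ) hΔ' (H := (ThetaSetting.modelχ p).GtpYdd) (H' := (ThetaSetting.modelχ p).GtpYdd) hY
              (etaDdχ p) =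
            ContH1.conj (ThetaSetting.modelχ p).toTheta (ThetaSetting.modelχ p).DeltaTheta σ₀ (etaDdχ p) := by
  refine ⟨cLevelDataInvχ p, fun x => ?_⟩
  obtain ⟨β, hβ, hΔ', hY, h₁, -, h⟩ := outer_pair_pC5_cLevelDataInvχ p x
  exact ⟨_, β, hβ, hΔ', hY, rfl, h₁, _, h⟩

end Literature.AnabelianGeometry.EtaleTheta.SettingModel

end
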